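import Mathlib
import Literature.Analysis.FunctionSpaces.Complexify
import HarnessLib

/-!
# Door S32 «CalmPocketDoor» (stmt-NavierStokesRegularity-0056, ROUND-30), plate Q32 — bricks (Qa) + (Qb):
# THE THICK SHELL TUBE IS OPEN AND CONNECTED, AND A HOLOMORPHIC MAP VANISHING ON A REAL BALL VANISHES NEARBY

Text of record for the door: nsreg-p1 `r30/Sketch32.lean` v2 (sha16 d8e333116c9f1838): `shell R := {x | 1/2 ≤ ‖x‖ ∧ ‖x‖ ≤ R}`,
`cTube A r := ⋃ x ∈ A, ball (complexify x) r` (both UNFOLDED below; `E³ = EuclideanSpace ℝ (Fin 3)`, `ℂ³ = EuclideanSpace ℂ (Fin 3)` spelled out).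
These are the two geometric/analytic inputs of the SOFT route to plate Q32 `PocketPropagation` (PLATE-AID-32 v2 Δ2: contradiction +
Montel `Literature.Analysis.Complex.SCV.exists_strictMono_tendstoLocallyUniformlyOn_of_norm_le` on the fixed tube + identity theorem):

* `shell_eq_image_smul`, `isPathConnected_shell` — the closed shell `{1/2 ≤ ‖x‖ ≤ R}` (`R ≥ 1/2`) is the continuous image of
  `[1/2,R] × S²`, hence path-connected;
* `isOpen_cTube`, `isPathConnected_cTube`, `isPreconnected_cTube` — the tube `⋃_{x ∈ shell} B_ℂ³(complexify x, r₀)` is open and (path-)connected;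
* `re_add_im_decomposition`, `norm_rePart_sub_le`, `norm_imPart_le` — `z = complexify (Re z) + I • complexify (Im z)` (coordinatewise parts) with
  `‖Re z − x‖, ‖Im z‖ ≤ ‖z − complexify x‖`;
* `eq_zero_near_of_eq_zero_on_real_ball` — **(Qa) REAL-SLICE IDENTITY**: a map holomorphic on `B_ℂ³(complexify x, ρ)` which vanishes at the
  real points `complexify y`, `y ∈ B(x, r)`, vanishes on `B_ℂ³(complexify x, min r ρ / 4)` (one-variable identity theorem on the complex line
  `ζ ↦ complexify (Re z) + ζ • complexify (Im z)`, which is real for real `ζ` and passes through `z` at `ζ = I`).  This also serves the F32c glue.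

WHAT THIS IS NOT: not NS regularity, not the door — elementary bricks `--supports` stmt-0056 for the Q32 plate of a regularity CRITERION (0056 is NOT
proved). [folklore]
-/

noncomputable section

set_option linter.dupNamespace false

open MeasureTheory Set Filter Topology Metric Function Complex
open scoped NNReal ENNReal Topology

namespace Summit.NavierStokesRegularity.NavierStokesRegularity.Theorems.CalmPocketDoor

open Literature.Analysis.FunctionSpaces.EuclideanSpace (complexify complexify_apply norm_complexify continuous_complexify)

/-! ### (Qb) The shell and its tube -/

/-- The closed shell is the image of `[1/2, R] × S²` under `(t, v) ↦ t • v`. [folklore] -/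
theorem shell_eq_image_smul (R : ℝ) :
    {x : EuclideanSpace ℝ (Fin 3) | 1 / 2 ≤ ‖x‖ ∧ ‖x‖ ≤ R} =
      (fun p : ℝ × EuclideanSpace ℝ (Fin 3) => p.1 • p.2) '' (Icc (1 / 2) R ×ˢ sphere (0 : EuclideanSpace ℝ (Fin 3)) 1) := by
  ext x
  simp only [mem_setOf_eq, mem_image, mem_prod, mem_Icc, mem_sphere, dist_zero_right, Prod.exists]
  constructor
  · rintro ⟨h1, h2⟩
    have hx0 : 0 < ‖x‖ := by linarith
    refine ⟨‖x‖, ‖x‖⁻¹ • x, ⟨⟨h1, h2⟩, ?_⟩, ?_⟩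
    · rw [norm_smul, norm_inv, norm_norm, inv_mul_cancel₀ hx0.ne']
    · rw [smul_smul, mul_inv_cancel₀ hx0.ne', one_smul]
  · rintro ⟨t, v, ⟨⟨ht1, ht2⟩, hv⟩, rfl⟩
    have ht0 : 0 ≤ t := by linarith
    rw [norm_smul, Real.norm_eq_abs, abs_of_nonneg ht0, hv, mul_one]
    exact ⟨ht1, ht2⟩

/-- `ℝ³` has dimension `> 1` (for the connectedness of spheres). [folklore] -/
theorem one_lt_rank_euclideanSpace_fin_three : 1 < Module.rank ℝ (EuclideanSpace ℝ (Fin 3)) := by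
  rw [← Module.finrank_eq_rank, finrank_euclideanSpace, Fintype.card_fin]
  norm_num

/-- The closed shell `{1/2 ≤ ‖x‖ ≤ R}`, `R ≥ 1/2`, is path-connected. [folklore] -/
theorem isPathConnected_shell {R : ℝ} (hR : 1 / 2 ≤ R) :
    IsPathConnected {x : EuclideanSpace ℝ (Fin 3) | 1 / 2 ≤ ‖x‖ ∧ ‖x‖ ≤ R} := by
  rw [shell_eq_image_smul]
  refine IsPathConnected.image ?_ (continuous_fst.smul continuous_snd)
  exact ((convex_Icc (1 / 2 : ℝ) R).isPathConnected ⟨1 / 2, left_mem_Icc.2 hR⟩).prod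
    (isPathConnected_sphere one_lt_rank_euclideanSpace_fin_three 0 zero_le_one)

/-- The thick shell tube `⋃_{x ∈ shell} B(complexify x, r₀)` is open. [folklore] -/
theorem isOpen_cTube (A : Set (EuclideanSpace ℝ (Fin 3))) (r₀ : ℝ) :
    IsOpen (⋃ x ∈ A, ball (complexify x) r₀ : Set (EuclideanSpace ℂ (Fin 3))) :=
  isOpen_biUnion fun _ _ => isOpen_ball

/-- A tube of positive radius over a nonempty path-connected real set is path-connected (centres are joined inside the complexified set, points to
their centre inside a ball). [folklore] -/
theorem isPathConnected_cTube_of_isPathConnected {A : Set (EuclideanSpace ℝ (Fin 3))} (hA : IsPathConnected A) {r₀ : ℝ} (hr₀ : 0 < r₀) :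
    IsPathConnected (⋃ x ∈ A, ball (complexify x) r₀ : Set (EuclideanSpace ℂ (Fin 3))) := by
  set T : Set (EuclideanSpace ℂ (Fin 3)) := ⋃ x ∈ A, ball (complexify x) r₀ with hT
  have hS : IsPathConnected (complexify '' A) := hA.image continuous_complexify
  have hST : complexify '' A ⊆ T := by
    rintro _ ⟨x, hx, rfl⟩
    exact mem_iUnion₂.2 ⟨x, hx, mem_ball_self hr₀⟩
  have hballT : ∀ x ∈ A, ball (complexify x) r₀ ⊆ T := fun x hx => subset_iUnion₂ (s := fun x _ => ball (complexify x) r₀) x hx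
  obtain ⟨x₀, hx₀⟩ := hA.nonempty
  refine ⟨complexify x₀, hST ⟨x₀, hx₀, rfl⟩, fun {y} hy => ?_⟩
  obtain ⟨x, hx, hyx⟩ := mem_iUnion₂.1 hy
  have h1 : JoinedIn T (complexify x₀) (complexify x) := (hS.joinedIn _ ⟨x₀, hx₀, rfl⟩ _ ⟨x, hx, rfl⟩).mono hST
  have h2 : JoinedIn T (complexify x) y :=
    (((convex_ball (complexify x) r₀).isPathConnected ⟨_, mem_ball_self hr₀⟩).joinedIn _ (mem_ball_self hr₀) _ hyx).mono
      (hballT x hx)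
  exact h1.trans h2

/-- The thick shell tube over `{1/2 ≤ ‖x‖ ≤ R}` (`R ≥ 1/2`, `r₀ > 0`) is path-connected. [folklore] -/
theorem isPathConnected_cTube {R r₀ : ℝ} (hR : 1 / 2 ≤ R) (hr₀ : 0 < r₀) :
    IsPathConnected (⋃ x ∈ {x : EuclideanSpace ℝ (Fin 3) | 1 / 2 ≤ ‖x‖ ∧ ‖x‖ ≤ R}, ball (complexify x) r₀ :
      Set (EuclideanSpace ℂ (Fin 3))) :=
  isPathConnected_cTube_of_isPathConnected (isPathConnected_shell hR) hr₀

/-- The thick shell tube is preconnected. [folklore] -/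
theorem isPreconnected_cTube {R r₀ : ℝ} (hR : 1 / 2 ≤ R) (hr₀ : 0 < r₀) :
    IsPreconnected (⋃ x ∈ {x : EuclideanSpace ℝ (Fin 3) | 1 / 2 ≤ ‖x‖ ∧ ‖x‖ ≤ R}, ball (complexify x) r₀ :
      Set (EuclideanSpace ℂ (Fin 3))) :=
  (isPathConnected_cTube hR hr₀).isConnected.isPreconnected

/-! ### (Qa) Real and imaginary parts; the real-slice identity -/

/-- `z = complexify (Re z) + I • complexify (Im z)` (coordinatewise real and imaginary parts). [folklore] -/
theorem re_add_im_decomposition (z : EuclideanSpace ℂ (Fin 3)) :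
    complexify (WithLp.toLp 2 (fun i => (z i).re) : EuclideanSpace ℝ (Fin 3)) +
        (I : ℂ) • complexify (WithLp.toLp 2 (fun i => (z i).im) : EuclideanSpace ℝ (Fin 3)) = z := by
  ext i
  simp only [PiLp.add_apply, PiLp.smul_apply, complexify_apply, smul_eq_mul]
  rw [mul_comm]
  exact Complex.re_add_im (z i)

/-- For real `t`: `complexify a + (t : ℂ) • complexify b = complexify (a + t • b)`. [folklore] -/
theorem complexify_add_real_smul (a b : EuclideanSpace ℝ (Fin 3)) (t : ℝ) :
    complexify a + ((t : ℂ)) • complexify b = complexify (a + t • b) := by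
  ext i
  simp only [PiLp.add_apply, PiLp.smul_apply, complexify_apply, smul_eq_mul, Complex.ofReal_add, Complex.ofReal_mul]

/-- `‖Re z − x‖ ≤ ‖z − complexify x‖`. [folklore] -/
theorem norm_rePart_sub_le (z : EuclideanSpace ℂ (Fin 3)) (x : EuclideanSpace ℝ (Fin 3)) :
    ‖(WithLp.toLp 2 (fun i => (z i).re) : EuclideanSpace ℝ (Fin 3)) - x‖ ≤ ‖z - complexify x‖ := by
  rw [EuclideanSpace.norm_eq, EuclideanSpace.norm_eq]
  refine Real.sqrt_le_sqrt (Finset.sum_le_sum fun i _ => ?_)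
  have h : ((WithLp.toLp 2 (fun i => (z i).re) : EuclideanSpace ℝ (Fin 3)) - x) i = ((z - complexify x) i).re := by
    simp only [PiLp.sub_apply, complexify_apply, Complex.sub_re, Complex.ofReal_re]
  rw [h, Real.norm_eq_abs]
  have := Complex.abs_re_le_norm ((z - complexify x) i)
  nlinarith [abs_nonneg (((z - complexify x) i).re), norm_nonneg ((z - complexify x) i)]

/-- `‖Im z‖ ≤ ‖z − complexify x‖`. [folklore] -/
theorem norm_imPart_le (z : EuclideanSpace ℂ (Fin 3)) (x : EuclideanSpace ℝ (Fin 3)) :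
    ‖(WithLp.toLp 2 (fun i => (z i).im) : EuclideanSpace ℝ (Fin 3))‖ ≤ ‖z - complexify x‖ := by
  rw [EuclideanSpace.norm_eq, EuclideanSpace.norm_eq]
  refine Real.sqrt_le_sqrt (Finset.sum_le_sum fun i _ => ?_)
  have h : (WithLp.toLp 2 (fun i => (z i).im) : EuclideanSpace ℝ (Fin 3)) i = ((z - complexify x) i).im := by
    simp only [PiLp.sub_apply, complexify_apply, Complex.sub_im, Complex.ofReal_im, sub_zero]
  rw [h, Real.norm_eq_abs]
  have := Complex.abs_im_le_norm ((z - complexify x) i)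
  nlinarith [abs_nonneg (((z - complexify x) i).im), norm_nonneg ((z - complexify x) i)]

/-- **(Qa) REAL-SLICE IDENTITY.**  Let `F : ℂ³ → G` be holomorphic on the ball `B(complexify x, ρ)` and vanish at the real points `complexify y`,
`y ∈ B(x, r)`.  Then `F = 0` on `B(complexify x, min r ρ / 4)`.  (On the complex line `ζ ↦ complexify (Re z) + ζ • complexify (Im z)` through
`z` (at `ζ = I`), `F` is a one-variable holomorphic function vanishing at all small real `ζ`; identity theorem.) [folklore] -/
theorem eq_zero_near_of_eq_zero_on_real_ball {G : Type*} [NormedAddCommGroup G] [NormedSpace ℂ G] [CompleteSpace G]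
    {F : EuclideanSpace ℂ (Fin 3) → G} {x : EuclideanSpace ℝ (Fin 3)} {ρ r : ℝ}
    (hF : DifferentiableOn ℂ F (ball (complexify x) ρ)) (hvan : ∀ y ∈ ball x r, F (complexify y) = 0) :
    ∀ z ∈ ball (complexify x) (min r ρ / 4), F z = 0 := by
  intro z hz
  rw [mem_ball, dist_eq_norm] at hz
  set s : ℝ := ‖z - complexify x‖ with hs
  have hs0 : 0 ≤ s := norm_nonneg _
  have hsr : 4 * s < r := by have := min_le_left r ρ; linarith
  have hsρ : 4 * s < ρ := by have := min_le_right r ρ; linarith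
  set a : EuclideanSpace ℝ (Fin 3) := WithLp.toLp 2 (fun i => (z i).re) with ha
  set b : EuclideanSpace ℝ (Fin 3) := WithLp.toLp 2 (fun i => (z i).im) with hb
  have hax : ‖a - x‖ ≤ s := norm_rePart_sub_le z x
  have hbs : ‖b‖ ≤ s := norm_imPart_le z x
  -- the complex line through `z`
  set φ : ℂ → EuclideanSpace ℂ (Fin 3) := fun ζ => complexify a + ζ • complexify b with hφ
  have hφI : φ I = z := re_add_im_decomposition z
  have hφd : Differentiable ℂ φ := (differentiable_const _).add (differentiable_id.smul_const _)
  have hφball : ∀ ζ : ℂ, ‖ζ‖ < 3 → φ ζ ∈ ball (complexify x) ρ := by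
    intro ζ hζ
    rw [mem_ball, dist_eq_norm, hφ]
    simp only []
    have e : complexify a + ζ • complexify b - complexify x = complexify (a - x) + ζ • complexify b := by
      rw [map_sub]; abel
    rw [e]
    calc ‖complexify (a - x) + ζ • complexify b‖ ≤ ‖complexify (a - x)‖ + ‖ζ • complexify b‖ := norm_add_le _ _
      _ = ‖a - x‖ + ‖ζ‖ * ‖b‖ := by rw [norm_complexify, norm_smul, norm_complexify]
      _ ≤ s + 3 * s := by gcongr
      _ < ρ := by linarith
  -- the one-variable function
  set g : ℂ → G := fun ζ => F (φ ζ) with hg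
  have hgd : DifferentiableOn ℂ g (ball (0 : ℂ) 3) := by
    intro ζ hζ
    rw [mem_ball, dist_zero_right] at hζ
    have h1 : DifferentiableAt ℂ F (φ ζ) := hF.differentiableAt (isOpen_ball.mem_nhds (hφball ζ hζ))
    exact (h1.comp ζ (hφd ζ)).differentiableWithinAt
  have hga : AnalyticOnNhd ℂ g (ball (0 : ℂ) 3) := hgd.analyticOnNhd isOpen_ball
  -- `g` vanishes at the real points near `0`
  have hreal : ∀ t : ℝ, |t| < 1 → g (t : ℂ) = 0 := by
    intro t ht
    have hφt : φ (t : ℂ) = complexify (a + t • b) := complexify_add_real_smul a b t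
    have hmem : a + t • b ∈ ball x r := by
      rw [mem_ball, dist_eq_norm]
      calc ‖a + t • b - x‖ = ‖(a - x) + t • b‖ := by abel_nf
        _ ≤ ‖a - x‖ + ‖t • b‖ := norm_add_le _ _
        _ = ‖a - x‖ + |t| * ‖b‖ := by rw [norm_smul, Real.norm_eq_abs]
        _ ≤ s + 1 * s := by gcongr
        _ < r := by linarith
    simp only [hg, hφt]
    exact hvan _ hmem
  have hfreq : ∃ᶠ ζ in 𝓝[≠] (0 : ℂ), g ζ = 0 := by
    -- along the real sequence `1/(n+1) → 0`
    set t : ℕ → ℝ := fun n => 1 / ((n : ℝ) + 1) with ht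
    have ht0 : Tendsto t atTop (𝓝 0) := tendsto_one_div_add_atTop_nhds_zero_nat
    have htpos : ∀ n, 0 < t n := fun n => by rw [ht]; positivity
    have htC : Tendsto (fun n => ((t n : ℝ) : ℂ)) atTop (𝓝[≠] (0 : ℂ)) := by
      refine tendsto_nhdsWithin_iff.2 ⟨?_, Eventually.of_forall fun n => ?_⟩
      · have h := (Complex.continuous_ofReal.tendsto 0).comp ht0
        rw [Complex.ofReal_zero] at h
        exact h
      · exact fun h => (htpos n).ne' (Complex.ofReal_eq_zero.1 h)
    have hev : ∀ᶠ n in atTop, g ((t n : ℝ) : ℂ) = 0 := by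
      refine eventually_atTop.2 ⟨1, fun n hn => hreal (t n) ?_⟩
      rw [abs_of_pos (htpos n), ht]
      simp only []
      rw [div_lt_one (by positivity)]
      have : (1 : ℝ) ≤ n := by exact_mod_cast hn
      linarith
    exact htC.frequently hev.frequently
  have hzero : EqOn g 0 (ball (0 : ℂ) 3) :=
    hga.eqOn_zero_of_preconnected_of_frequently_eq_zero (convex_ball _ _).isPreconnected (mem_ball_self (by norm_num)) hfreq
  have hI : (I : ℂ) ∈ ball (0 : ℂ) 3 := by
    rw [mem_ball, dist_zero_right, Complex.norm_I]; norm_num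
  have := hzero hI
  rw [hg] at this
  simpa only [hφI, Pi.zero_apply] using this

end Summit.NavierStokesRegularity.NavierStokesRegularity.Theorems.CalmPocketDoor

end
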